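import Mathlib
import HarnessLib
import Literature.Analysis.FluidPDE.VectorCalculus
import Literature.Analysis.FluidPDE.NewtonKernel
import Literature.Analysis.FluidPDE.NormalisedPressureFarFieldLimit
import Literature.Analysis.FluidPDE.ClassicalLerayProjection
import Summits.NavierStokesRegularity.NavierStokesRegularity.Theorems.UnthreadedRigidityDoorUnthreadedRigidityVirialHornAnalyticWedge

/-!
# Route `UnthreadedRigidityDoor`, item `UnthreadedRigidity` (W2, stmt-NavierStokesRegularity-27585) — LINE g11-1 «VIRIAL HORN»:
# jets of a solid harmonic (Euler identities, symmetric Hessian and third derivative, traces, the angular form and its derivative)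

Prover file (engine-1 g71, free prover hand; `--supports stmt-NavierStokesRegularity-27585 --as helper`) for LINE g11-1 «VIRIAL HORN»
of planner ns-idea-6 g11 (objects BY NAME in `…VirialHornDefs.lean`, p695782).  Calculus layer, part 1, of the ANGULAR LEMMA S-C in every
degree: for a solid harmonic `Y` of degree `l` (a homogeneous harmonic polynomial), with `g = ∇Y`, `S(y) = D(∇Y)(y)`, `T(y) = D²(∇Y)(y)`:
`Y(c y) = c^l Y(y)`; Euler `⟪y, g⟫ = lY`, `S(y) y = (l−1) g`, `T(y) y = (l−2) S(y)`; `S`, `T` symmetric; `tr S = 0` (this is `lap3 Y = 0`) and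
`tr T(y) w = 0`; the gradient of `|∇Y|²` is `2 S g`, so the angular form is `{Y,|∇Y|²}(y) = 2⟪y × g, S g⟫`, and when it vanishes identically its
derivative gives `⟪y × S w + w × g, S g⟫ + ⟪y × g, S(S w) + T w g⟫ = 0`.  These are exactly the pointwise inputs of `cross_axisDeriv_axis_eq_zero`
(`…VirialHornAngularKey.lean`).  Tree tools reused: `Literature.Analysis.FluidPDE.fderiv_homogeneous` / `fderiv_apply_self_of_homogeneous` (Euler),
`contDiff_gradient_of_contDiff_top`, `hasFDerivAt_cross`, `IsSolidHarmonic.contDiff`.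

HONEST LABEL: multivariable calculus about SPECIAL separable data (support S-C of a RUNG line); `UnthreadedRigidity` (27585), W2 and NS regularity
remain OPEN; nothing here is a statement about the Navier–Stokes equations.  0 kit.
-/

-- the summit and its single sub-problem share the name (CONVENTIONS §1), as in every Theorems file
set_option linter.dupNamespace false

namespace Summit.NavierStokesRegularity.NavierStokesRegularity.Theorems.UnthreadedRigidity.VirialHorn

open scoped InnerProductSpace Topology ContDiff
open Filter Set
open Literature.Analysis.FluidPDE (cross crossCLM hasFDerivAt_cross fderiv_homogeneous fderiv_apply_self_of_homogeneous
  contDiff_gradient_of_contDiff_top)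
open Summit.NavierStokesRegularity.NavierStokesRegularity.Theorems.UnthreadedRigidity.ProfileHorn (E3)

/-! ## Generic second/third derivative bookkeeping for a smooth scalar function -/

section Generic

variable {θ : E3 → ℝ}

/-- `⟪D(∇θ)(x) u, w⟫ = D²θ(x)(u)(w)`. -/
theorem inner_fderiv_gradient (hθ : ContDiff ℝ 2 θ) (x u w : E3) :
    ⟪fderiv ℝ (gradient θ) x u, w⟫_ℝ = fderiv ℝ (fderiv ℝ θ) x u w := by
  set L : (E3 →L[ℝ] ℝ) →L[ℝ] E3 :=
    (InnerProductSpace.toDual ℝ E3).symm.toContinuousLinearEquiv.toContinuousLinearMap with hL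
  have hd : DifferentiableAt ℝ (fderiv ℝ θ) x :=
    ((hθ.fderiv_right (m := 1) le_rfl).differentiable one_ne_zero) x
  have h1 : gradient θ = fun y => L (fderiv ℝ θ y) := rfl
  have h2 : HasFDerivAt (fun y => L (fderiv ℝ θ y)) (L.comp (fderiv ℝ (fderiv ℝ θ) x)) x :=
    L.hasFDerivAt.comp x hd.hasFDerivAt
  rw [h1, h2.fderiv, ContinuousLinearMap.comp_apply]
  show ⟪(InnerProductSpace.toDual ℝ E3).symm (fderiv ℝ (fderiv ℝ θ) x u), w⟫_ℝ = _
  rw [InnerProductSpace.toDual_symm_apply]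

/-- the Hessian-as-a-map is symmetric: `⟪D(∇θ) u, w⟫ = ⟪u, D(∇θ) w⟫`. -/
theorem inner_fderiv_gradient_symm (hθ : ContDiff ℝ 2 θ) (x u w : E3) :
    ⟪fderiv ℝ (gradient θ) x u, w⟫_ℝ = ⟪u, fderiv ℝ (gradient θ) x w⟫_ℝ := by
  rw [inner_fderiv_gradient hθ, real_inner_comm (fderiv ℝ (gradient θ) x w) u, inner_fderiv_gradient hθ]
  exact (hθ.contDiffAt.isSymmSndFDerivAt (by simp)) u w

/-- `D(y ↦ D(∇θ)(y) w)(x) u = D²(∇θ)(x) u w`. -/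
theorem fderiv_fderiv_gradient_apply (hθ : ContDiff ℝ 3 θ) (x u w : E3) :
    fderiv ℝ (fun y => fderiv ℝ (gradient θ) y w) x u = fderiv ℝ (fderiv ℝ (gradient θ)) x u w := by
  have hg : ContDiff ℝ 2 (gradient θ) :=
    (InnerProductSpace.toDual ℝ E3).symm.contDiff.comp (hθ.fderiv_right (m := 2) le_rfl)
  have hd : DifferentiableAt ℝ (fderiv ℝ (gradient θ)) x :=
    ((hg.fderiv_right (m := 1) le_rfl).differentiable one_ne_zero) x
  rw [fderiv_clm_apply hd (differentiableAt_const w)]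
  simp only [fderiv_fun_const, Pi.zero_apply, ContinuousLinearMap.comp_zero, zero_add,
    ContinuousLinearMap.flip_apply]

/-- symmetry of `D²(∇θ)` in its two arguments. -/
theorem fderiv_fderiv_gradient_symm (hθ : ContDiff ℝ 3 θ) (x u w : E3) :
    fderiv ℝ (fderiv ℝ (gradient θ)) x u w = fderiv ℝ (fderiv ℝ (gradient θ)) x w u := by
  have hg : ContDiff ℝ 2 (gradient θ) :=
    (InnerProductSpace.toDual ℝ E3).symm.contDiff.comp (hθ.fderiv_right (m := 2) le_rfl)
  exact (hg.contDiffAt.isSymmSndFDerivAt (by simp)) u w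

/-- `D²(∇θ)(x) u` is again symmetric as a map: `⟪D²(∇θ) u w, z⟫ = ⟪D²(∇θ) u z, w⟫`. -/
theorem inner_fderiv_fderiv_gradient_symm (hθ : ContDiff ℝ 3 θ) (x u w z : E3) :
    ⟪fderiv ℝ (fderiv ℝ (gradient θ)) x u w, z⟫_ℝ = ⟪fderiv ℝ (fderiv ℝ (gradient θ)) x u z, w⟫_ℝ := by
  have hθ2 : ContDiff ℝ 2 θ := hθ.of_le (by norm_cast)
  have hg : ContDiff ℝ 2 (gradient θ) :=
    (InnerProductSpace.toDual ℝ E3).symm.contDiff.comp (hθ.fderiv_right (m := 2) le_rfl)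
  have hd : DifferentiableAt ℝ (fderiv ℝ (gradient θ)) x :=
    ((hg.fderiv_right (m := 1) le_rfl).differentiable one_ne_zero) x
  -- the scalar functions `y ↦ ⟪D(∇θ)(y) w, z⟫` and `y ↦ ⟪D(∇θ)(y) z, w⟫` coincide
  have hfun : (fun y => ⟪fderiv ℝ (gradient θ) y w, z⟫_ℝ) = fun y => ⟪fderiv ℝ (gradient θ) y z, w⟫_ℝ := by
    funext y
    rw [inner_fderiv_gradient_symm hθ2, real_inner_comm]
  -- their derivatives along `u`
  have hder : ∀ w z : E3, fderiv ℝ (fun y => ⟪fderiv ℝ (gradient θ) y w, z⟫_ℝ) x u =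
      ⟪fderiv ℝ (fderiv ℝ (gradient θ)) x u w, z⟫_ℝ := by
    intro w z
    have h1 : HasFDerivAt (fun y => fderiv ℝ (gradient θ) y w) ((fderiv ℝ (fderiv ℝ (gradient θ)) x).flip w) x := by
      have := hd.hasFDerivAt.clm_apply (hasFDerivAt_const w x)
      simpa using this
    have h2 := h1.inner (𝕜 := ℝ) (hasFDerivAt_const z x)
    rw [h2.fderiv]
    simp [fderivInnerCLM_apply, ContinuousLinearMap.flip_apply]
  have := congrArg (fun f => fderiv ℝ f x u) hfun
  simp only [hder] at this
  exact this

end Generic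

/-! ## Jets of a solid harmonic -/

section SolidHarmonic

variable {l : ℕ} {Y : E3 → ℝ}

/-- homogeneity: `Y(c y) = c^l Y(y)`. -/
theorem IsSolidHarmonic.apply_smul (hY : IsSolidHarmonic l Y) (c : ℝ) (y : E3) : Y (c • y) = c ^ l * Y y := by
  obtain ⟨P, hP, hYP⟩ := hY.1
  rw [hYP, hYP]
  have harg : (fun i => (c • y) i) = c • (fun i => y i) := by
    funext i; simp
  rw [harg, MvPolynomial.eval_eq', MvPolynomial.eval_eq', Finset.mul_sum]
  refine Finset.sum_congr rfl fun α hα => ?_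
  have hdeg : ∑ i, α i = l := by
    rw [← Finsupp.degree_eq_sum, Finsupp.degree_apply]
    exact (hP.degree_eq_sum_deg_support hα).symm
  simp_rw [Pi.smul_apply, smul_eq_mul, mul_pow, Finset.prod_mul_distrib, Finset.prod_pow_eq_pow_sum, hdeg]
  ring

/-- homogeneity with an integer exponent, `c > 0` (the form of the tree's Euler lemmas). -/
theorem IsSolidHarmonic.apply_smul_zpow (hY : IsSolidHarmonic l Y) (c : ℝ) (y : E3) :
    Y (c • y) = c ^ (l : ℤ) • Y y := by
  rw [hY.apply_smul, zpow_natCast, smul_eq_mul]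

/-- the gradient of a solid harmonic is smooth. -/
theorem IsSolidHarmonic.contDiff_gradient (hY : IsSolidHarmonic l Y) : ContDiff ℝ ∞ (gradient Y) :=
  contDiff_gradient_of_contDiff_top hY.contDiff

/-- the Hessian field of a solid harmonic is smooth. -/
theorem IsSolidHarmonic.contDiff_hessian (hY : IsSolidHarmonic l Y) : ContDiff ℝ ∞ (fderiv ℝ (gradient Y)) :=
  hY.contDiff_gradient.fderiv_right (m := ∞) le_rfl

/-- homogeneity of the gradient: `∇Y(c y) = c^{l−1} ∇Y(y)`, `c > 0`. -/
theorem IsSolidHarmonic.gradient_smul (hY : IsSolidHarmonic l Y) (c : ℝ) (hc : 0 < c) (y : E3) :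
    gradient Y (c • y) = c ^ ((l : ℤ) - 1) • gradient Y y := by
  have h := fderiv_homogeneous Y (l : ℤ) (fun c _ z => hY.apply_smul_zpow c z) c hc y
  show (InnerProductSpace.toDual ℝ E3).symm (fderiv ℝ Y (c • y)) = c ^ ((l : ℤ) - 1) • (InnerProductSpace.toDual ℝ E3).symm (fderiv ℝ Y y)
  rw [h, LinearIsometryEquiv.map_smulₛₗ]
  simp

/-- homogeneity of the Hessian field: `D(∇Y)(c y) = c^{l−2} D(∇Y)(y)`, `c > 0`. -/
theorem IsSolidHarmonic.hessian_smul (hY : IsSolidHarmonic l Y) (c : ℝ) (hc : 0 < c) (y : E3) :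
    fderiv ℝ (gradient Y) (c • y) = c ^ ((l : ℤ) - 1 - 1) • fderiv ℝ (gradient Y) y :=
  fderiv_homogeneous (gradient Y) ((l : ℤ) - 1) (fun c hc z => hY.gradient_smul c hc z) c hc y

/-- Euler, order one: `⟪y, ∇Y(y)⟫ = l Y(y)`. -/
theorem IsSolidHarmonic.inner_self_gradient (hY : IsSolidHarmonic l Y) (y : E3) : ⟪y, gradient Y y⟫_ℝ = (l : ℝ) * Y y := by
  have h := fderiv_apply_self_of_homogeneous Y (l : ℤ) (fun c _ z => hY.apply_smul_zpow c z)
    ((hY.contDiff.differentiable (by simp)) y)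
  rw [real_inner_comm (gradient Y y) y]
  show ⟪(InnerProductSpace.toDual ℝ E3).symm (fderiv ℝ Y y), y⟫_ℝ = _
  rw [InnerProductSpace.toDual_symm_apply, h]
  push_cast
  rw [smul_eq_mul]

/-- Euler, order two: `D(∇Y)(y) y = (l−1) ∇Y(y)`. -/
theorem IsSolidHarmonic.hessian_apply_self (hY : IsSolidHarmonic l Y) (y : E3) :
    fderiv ℝ (gradient Y) y y = ((l : ℝ) - 1) • gradient Y y := by
  have h := fderiv_apply_self_of_homogeneous (gradient Y) ((l : ℤ) - 1) (fun c hc z => hY.gradient_smul c hc z)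
    ((hY.contDiff_gradient.differentiable (by simp)) y)
  rw [h]; push_cast; rfl

/-- Euler, order three: `D²(∇Y)(y) y w = (l−2) D(∇Y)(y) w`. -/
theorem IsSolidHarmonic.third_apply_self (hY : IsSolidHarmonic l Y) (y w : E3) :
    fderiv ℝ (fderiv ℝ (gradient Y)) y y w = ((l : ℝ) - 2) • fderiv ℝ (gradient Y) y w := by
  have h := fderiv_apply_self_of_homogeneous (fderiv ℝ (gradient Y)) ((l : ℤ) - 1 - 1)
    (fun c hc z => hY.hessian_smul c hc z) ((hY.contDiff_hessian.differentiable (by simp)) y)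
  rw [h, FunLike.coe_smul, Pi.smul_apply]; push_cast; ring_nf

/-- the Hessian is symmetric. -/
theorem IsSolidHarmonic.hessian_symm (hY : IsSolidHarmonic l Y) (y u w : E3) :
    ⟪fderiv ℝ (gradient Y) y u, w⟫_ℝ = ⟪u, fderiv ℝ (gradient Y) y w⟫_ℝ :=
  inner_fderiv_gradient_symm (hY.contDiff.of_le (by norm_cast)) y u w

/-- the third derivative is symmetric in its two map arguments. -/
theorem IsSolidHarmonic.third_symm (hY : IsSolidHarmonic l Y) (y u w : E3) :
    fderiv ℝ (fderiv ℝ (gradient Y)) y u w = fderiv ℝ (fderiv ℝ (gradient Y)) y w u :=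
  fderiv_fderiv_gradient_symm (hY.contDiff.of_le (by norm_cast)) y u w

/-- the third derivative is symmetric as a map. -/
theorem IsSolidHarmonic.third_symm' (hY : IsSolidHarmonic l Y) (y u w z : E3) :
    ⟪fderiv ℝ (fderiv ℝ (gradient Y)) y u w, z⟫_ℝ = ⟪fderiv ℝ (fderiv ℝ (gradient Y)) y u z, w⟫_ℝ :=
  inner_fderiv_fderiv_gradient_symm (hY.contDiff.of_le (by norm_cast)) y u w z

/-- `dir2 Y v y = ⟪D(∇Y)(y) v, v⟫`. -/
theorem IsSolidHarmonic.dir2_eq (hY : IsSolidHarmonic l Y) (v y : E3) :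
    dir2 Y v y = ⟪fderiv ℝ (gradient Y) y v, v⟫_ℝ := by
  have hθ : ContDiff ℝ 2 Y := hY.contDiff.of_le (by norm_cast)
  have hd : DifferentiableAt ℝ (fderiv ℝ Y) y :=
    ((hθ.fderiv_right (m := 1) le_rfl).differentiable one_ne_zero) y
  unfold dir2
  rw [inner_fderiv_gradient hθ, fderiv_clm_apply hd (differentiableAt_const v)]
  simp only [fderiv_fun_const, Pi.zero_apply, ContinuousLinearMap.comp_zero, zero_add,
    ContinuousLinearMap.flip_apply]

/-- harmonicity as a trace: `Σᵢ ⟪D(∇Y)(y) eᵢ, eᵢ⟫ = 0`. -/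
theorem IsSolidHarmonic.trace_hessian (hY : IsSolidHarmonic l Y) (y : E3) :
    ∑ i : Fin 3, ⟪fderiv ℝ (gradient Y) y (e i), e i⟫_ℝ = 0 := by
  have h := hY.2 y
  unfold lap3 at h
  simpa only [hY.dir2_eq] using h

/-- harmonicity differentiated: `Σᵢ ⟪D²(∇Y)(y) w eᵢ, eᵢ⟫ = 0`. -/
theorem IsSolidHarmonic.trace_third (hY : IsSolidHarmonic l Y) (y w : E3) :
    ∑ i : Fin 3, ⟪fderiv ℝ (fderiv ℝ (gradient Y)) y w (e i), e i⟫_ℝ = 0 := by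
  have hθ : ContDiff ℝ 3 Y := hY.contDiff.of_le (by norm_cast)
  have hθ2 : ContDiff ℝ 2 Y := hY.contDiff.of_le (by norm_cast)
  have hd : DifferentiableAt ℝ (fderiv ℝ (gradient Y)) y := (hY.contDiff_hessian.differentiable (by simp)) y
  -- the trace function vanishes identically, hence so does its derivative
  have hfun : (fun z : E3 => ∑ i : Fin 3, ⟪fderiv ℝ (gradient Y) z (e i), e i⟫_ℝ) = fun _ => 0 :=
    funext fun z => hY.trace_hessian z
  have hder : ∀ i : Fin 3, HasFDerivAt (fun z : E3 => ⟪fderiv ℝ (gradient Y) z (e i), e i⟫_ℝ)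
      ((innerSL ℝ (e i)).comp ((fderiv ℝ (fderiv ℝ (gradient Y)) y).flip (e i))) y := by
    intro i
    have h1 : HasFDerivAt (fun z => fderiv ℝ (gradient Y) z (e i)) ((fderiv ℝ (fderiv ℝ (gradient Y)) y).flip (e i)) y := by
      have := hd.hasFDerivAt.clm_apply (hasFDerivAt_const (e i) y)
      simpa using this
    have h2 := h1.inner (𝕜 := ℝ) (hasFDerivAt_const (e i) y)
    refine h2.congr_fderiv ?_
    ext v
    simp only [ContinuousLinearMap.comp_apply, ContinuousLinearMap.prod_apply, fderivInnerCLM_apply,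
      ContinuousLinearMap.flip_apply, innerSL_apply_apply, _root_.zero_apply, inner_zero_right, zero_add]
    exact real_inner_comm (e i) (fderiv ℝ (fderiv ℝ (gradient Y)) y v (e i))
  have hsum := HasFDerivAt.fun_sum fun i (_ : i ∈ (Finset.univ : Finset (Fin 3))) => hder i
  have hzero : HasFDerivAt (fun z : E3 => ∑ i : Fin 3, ⟪fderiv ℝ (gradient Y) z (e i), e i⟫_ℝ) (0 : E3 →L[ℝ] ℝ) y := by
    rw [hfun]; exact hasFDerivAt_const 0 y
  have heq := hsum.unique hzero
  have := congrArg (fun L : E3 →L[ℝ] ℝ => L w) heq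
  simp only [FunLike.coe_sum, Finset.sum_apply, ContinuousLinearMap.comp_apply, ContinuousLinearMap.flip_apply,
    innerSL_apply_apply, _root_.zero_apply] at this
  rw [show (∑ i : Fin 3, ⟪fderiv ℝ (fderiv ℝ (gradient Y)) y w (e i), e i⟫_ℝ)
      = ∑ i : Fin 3, ⟪e i, fderiv ℝ (fderiv ℝ (gradient Y)) y w (e i)⟫_ℝ from
    Finset.sum_congr rfl fun i _ => real_inner_comm _ _]
  exact this

/-- the gradient of `|∇Y|²` is `2 D(∇Y) ∇Y`. -/
theorem IsSolidHarmonic.hasGradientAt_normSq (hY : IsSolidHarmonic l Y) (y : E3) :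
    HasGradientAt (fun z => ‖gradient Y z‖ ^ 2) ((2 : ℝ) • fderiv ℝ (gradient Y) y (gradient Y y)) y := by
  have hg : HasFDerivAt (gradient Y) (fderiv ℝ (gradient Y) y) y :=
    ((hY.contDiff_gradient.differentiable (by simp)) y).hasFDerivAt
  have h := hg.norm_sq
  rw [hasGradientAt_iff_hasFDerivAt]
  refine h.congr_fderiv ?_
  ext v
  rw [InnerProductSpace.toDual_apply_apply, real_inner_smul_left, hY.hessian_symm]
  simp [innerSL_apply_apply]

/-- the gradient of `|∇Y|²` as a function. -/
theorem IsSolidHarmonic.gradient_normSq (hY : IsSolidHarmonic l Y) (y : E3) :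
    gradient (fun z => ‖gradient Y z‖ ^ 2) y = (2 : ℝ) • fderiv ℝ (gradient Y) y (gradient Y y) :=
  (hY.hasGradientAt_normSq y).gradient

/-- a component of the cross product (private copy). -/
private theorem cross_apply_zero' (u v : E3) : cross u v 0 = u 1 * v 2 - u 2 * v 1 := by
  simp [cross, cross_apply]

/-- a component of the cross product (private copy). -/
private theorem cross_apply_one' (u v : E3) : cross u v 1 = u 2 * v 0 - u 0 * v 2 := by
  simp [cross, cross_apply]

/-- a component of the cross product (private copy). -/
private theorem cross_apply_two' (u v : E3) : cross u v 2 = u 0 * v 1 - u 1 * v 0 := by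
  simp [cross, cross_apply]

/-- the inner product in coordinates (private copy). -/
private theorem real_inner_e3' (u v : E3) : ⟪u, v⟫_ℝ = u 0 * v 0 + u 1 * v 1 + u 2 * v 2 := by
  simp [PiLp.inner_apply, Fin.sum_univ_three, mul_comm]

/-- `det[a,b,c] = ⟪a × b, c⟫` (coordinates). -/
private theorem det3_eq_inner_cross_left' (a b c : E3) : det3 a b c = ⟪cross a b, c⟫_ℝ := by
  rw [real_inner_e3', cross_apply_zero', cross_apply_one', cross_apply_two', det3]; ring

/-- THE ANGULAR FORM through the Hessian: `{Y,|∇Y|²}(y) = 2⟪y × ∇Y, D(∇Y) ∇Y⟫`. -/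
theorem IsSolidHarmonic.angForm_eq (hY : IsSolidHarmonic l Y) (y : E3) :
    angForm Y y = 2 * ⟪cross y (gradient Y y), fderiv ℝ (gradient Y) y (gradient Y y)⟫_ℝ := by
  unfold angForm pbr
  rw [hY.gradient_normSq, det3_eq_inner_cross_left', real_inner_smul_right]

/-- the rotation field `y ↦ y × ∇Y(y)` and its derivative `w ↦ y × D(∇Y) w + w × ∇Y`. -/
theorem IsSolidHarmonic.hasFDerivAt_rot (hY : IsSolidHarmonic l Y) (y : E3) :
    HasFDerivAt (fun z : E3 => cross z (gradient Y z))
      (crossCLM.precompR E3 y (fderiv ℝ (gradient Y) y) + crossCLM.precompL E3 (ContinuousLinearMap.id ℝ E3) (gradient Y y)) y :=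
  hasFDerivAt_cross (hasFDerivAt_id y) ((hY.contDiff_gradient.differentiable (by simp)) y).hasFDerivAt

/-- the field `y ↦ D(∇Y)(y) ∇Y(y)` and its derivative `w ↦ D(∇Y)(D(∇Y) w) + D²(∇Y) w ∇Y`. -/
theorem IsSolidHarmonic.hasFDerivAt_hessian_gradient (hY : IsSolidHarmonic l Y) (y : E3) :
    HasFDerivAt (fun z : E3 => fderiv ℝ (gradient Y) z (gradient Y z))
      ((fderiv ℝ (gradient Y) y).comp (fderiv ℝ (gradient Y) y) + (fderiv ℝ (fderiv ℝ (gradient Y)) y).flip (gradient Y y)) y :=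
  ((hY.contDiff_hessian.differentiable (by simp)) y).hasFDerivAt.clm_apply
    ((hY.contDiff_gradient.differentiable (by simp)) y).hasFDerivAt

/-- VANISHING ANGULAR FORM, DIFFERENTIATED: if `{Y,|∇Y|²} ≡ 0` then at every point and in every direction `w`
`⟪y × D(∇Y) w + w × ∇Y, D(∇Y) ∇Y⟫ + ⟪y × ∇Y, D(∇Y)(D(∇Y) w) + D²(∇Y) w ∇Y⟫ = 0`. -/
theorem IsSolidHarmonic.fderiv_angForm_eq_zero (hY : IsSolidHarmonic l Y) (hA : ∀ y : E3, angForm Y y = 0) (y w : E3) :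
    ⟪cross y (fderiv ℝ (gradient Y) y w) + cross w (gradient Y y), fderiv ℝ (gradient Y) y (gradient Y y)⟫_ℝ
      + ⟪cross y (gradient Y y),
          fderiv ℝ (gradient Y) y (fderiv ℝ (gradient Y) y w) + fderiv ℝ (fderiv ℝ (gradient Y)) y w (gradient Y y)⟫_ℝ = 0 := by
  have hfun : (fun z : E3 => ⟪cross z (gradient Y z), fderiv ℝ (gradient Y) z (gradient Y z)⟫_ℝ) = fun _ => 0 := by
    funext z
    have := hA z
    rw [hY.angForm_eq] at this
    linarith
  have h := (hY.hasFDerivAt_rot y).inner (𝕜 := ℝ) (hY.hasFDerivAt_hessian_gradient y)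
  have hzero : HasFDerivAt (fun z : E3 => ⟪cross z (gradient Y z), fderiv ℝ (gradient Y) z (gradient Y z)⟫_ℝ)
      (0 : E3 →L[ℝ] ℝ) y := by
    rw [hfun]; exact hasFDerivAt_const 0 y
  have heq := congrArg (fun L : E3 →L[ℝ] ℝ => L w) (h.unique hzero)
  simp only [_root_.zero_apply, ContinuousLinearMap.comp_apply, ContinuousLinearMap.prod_apply,
    fderivInnerCLM_apply, _root_.add_apply, ContinuousLinearMap.flip_apply,
    ContinuousLinearMap.precompR_apply, ContinuousLinearMap.compL_apply,
    ContinuousLinearMap.precompL_apply, Literature.Analysis.FluidPDE.crossCLM_apply, ContinuousLinearMap.id_apply] at heq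
  -- `heq : ⟪y × ∇Y, S (S w) + T w ∇Y⟫ + ⟪y × S w + w × ∇Y, S ∇Y⟫ = 0`
  linarith [heq]

end SolidHarmonic

end Summit.NavierStokesRegularity.NavierStokesRegularity.Theorems.UnthreadedRigidity.VirialHorn
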